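import Summits.KontsevichZagierPeriods.KontsevichZagierPeriods.Theorems.LinRedNormalFormArrangementNormalFormStubRebaseSimplePosOnePosParTripleFlat

/-!
# Stub `stub_rebaseSimplePosOnePos` (crux `ArrangementNormalForm`, line `janus-bands`) —
part `ParThinQuad`: triple cells reduced to THIN far-side cells, split into cells away from the
pole (`U`) and cells with a QUADRUPLE point (`Q`) — any base dimension

The residual hypothesis `HparTriple` of part `ParTripleFlat` (parallel transverse bands over a
product cell `{x'-rows M₀} × (ylo(x'), yhi(x'))` whose closed cell contains a triple point
`h = w = κ' = 0`; `h = yhi − ylo`, `w = v − u`, `κ' = u₀ + s ℓ₂`, `s` the common slope of the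
bounds) is cut down further, uniformly in the base dimension (this file and part `ParThinQuadCell`):
* the base pole lies on ONE side of the `y`-range over the whole `x'`-cell (`pole_one_side`);
  the NEAR side (`yhi ≤ ℓ₂` for `s > 0`, `ℓ₂ ≤ ylo` for `s < 0`) is closed by
  `RebasePos.good_parCell_nearSide` (part `ParTripleTools`);
* on the FAR side, cut the `x'`-cell by the rational hyperplane `w = ε h` (rule 1a, any rational
  `ε > 0`): where `ε h ≤ w` finitely many level splits close the band
  (`RebasePos.good_parLevel` with `N = ⌈|s|/ε⌉`); the THIN part `w < ε h` remains;
* on a thin far-side cell (`RebasePos.good_parCell_far_thin`) let `a ≥ 0` be the distance of the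
  pole to the `y`-range (`a = ylo − ℓ₂` for `s > 0`, `ℓ₂ − yhi` for `s < 0`, an `x'`-form). Either
  the closed cell contains a QUADRUPLE point `h = w = κ' = a = 0` (the `y`-range pinches ON the
  pole hyperplane and the apex of the band lies on the letter there) — residual hypothesis `HQ` —
  or, by the extreme value theorem on the compact closure of the domain,
  `max (h, w, |κ'|, a) ≥ μ > 0`; one cut at the rational level `a = δ' < μ` leaves a part
  `a > δ'` on which the pole stays at distance `≥ δ'` from the `y`-range — residual hypothesis
  `HU` (if its closed cell still contains a triple point; otherwise part `ParTriple` closes it) —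
  and a part `a < δ'` whose closed cell contains no triple point (`good_parCell_of_noTriple`).
The side split and the cut `w = ε h` are carried out in part `ParThinQuadCell`
(`RebasePos.good_parCell_of_thinQuad`), the assembly over all product cells in part `ParThinQuadFlat`.

Members at `B = 2` (`x' = (x₁, x₂)`, `s = 1`): `HU`:
`[{0 < x₂ < x₁ < 1, 0 < y < x₁, y + 1 − x₂/2 < t < y + 1 + x₂/2}, 1/(x₁² x₂ (y + 1) t)]`
(`h = x₁`, `w = x₂`, `κ' = −x₂/2`, `a = 1`); `HQ`:
`[{0 < x₂ < x₁ < 1, 0 < y < x₁, y + x₂ < t < y + 2 x₂}, 1/(x₁ (y + x₂) t)]`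
(`h = x₁`, `w = x₂`, `κ' = 0`, `a = x₂`; quadruple point `x' = 0`).

References: M. Kontsevich, D. Zagier, *Periods* (2001), §1.2, rules (1a), (1b), (2).
-/

noncomputable section

open Set MeasureTheory MvPolynomial
open Literature.NumberTheory.Transcendental Literature.ModelTheory.ExponentialFields

namespace Summit.KontsevichZagierPeriods.ArrangementNormalForm.JanusBands

namespace RebasePos

open SeparatePos

section ThinQuad

variable {B m m' m₀ : ℕ} (L : Fin m → (Fin B → ℚ) × ℚ) (e : Fin m → ℕ) (ℓ₁ ℓ₂ : (Fin B → ℚ) × ℚ)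

/-- A point of the closed base cell, with its `t`-coordinate moved to the middle of the fibre,
lies in the closure of the domain. -/
theorem update_mem_closure_domain (s : KZ.IntegralRep (B + 1 + 1)) (M : Fin m' → (Fin (B + 1) → ℚ) × ℚ)
    (u v : (Fin (B + 1) → ℚ) × ℚ) (hdom : s.domain = gDom B 1 m' M (fun _ => Sum.inr u) (fun _ => Sum.inr v))
    (hcell : ∀ z : Fin (B + 1 + 1) → ℝ, (∀ j, 0 < affF B 1 (M j) z) → 0 < affF B 1 u z ∧ affF B 1 u z < affF B 1 v z)
    {z : Fin (B + 1 + 1) → ℝ} (hz : z ∈ closure {z : Fin (B + 1 + 1) → ℝ | ∀ j, 0 < affF B 1 (M j) z}) :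
    Function.update z (tI B) ((affF B 1 u z + affF B 1 v z) / 2) ∈ closure s.domain := by
  set Ψ : (Fin (B + 1 + 1) → ℝ) → (Fin (B + 1 + 1) → ℝ) :=
    fun z => Function.update z (tI B) ((affF B 1 u z + affF B 1 v z) / 2) with hΨ
  have hΨc : Continuous Ψ :=
    continuous_id.update (tI B) (((continuous_affF u).add (continuous_affF v)).div_const 2)
  have himg : Ψ '' {z : Fin (B + 1 + 1) → ℝ | ∀ j, 0 < affF B 1 (M j) z} ⊆ s.domain := by
    rintro _ ⟨w, hw, rfl⟩
    obtain ⟨-, huv⟩ := hcell w hw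
    rw [hdom, mem_gDom_one]
    refine ⟨fun j => ?_, ?_, ?_⟩
    · rw [hΨ]
      dsimp only
      rw [affF_update_tI]
      exact hw j
    · rw [hΨ]
      dsimp only
      rw [affF_update_tI, show Fin.natAdd (B + 1) 0 = tI B from rfl, Function.update_self]
      linarith
    · rw [hΨ]
      dsimp only
      rw [affF_update_tI, show Fin.natAdd (B + 1) 0 = tI B from rfl, Function.update_self]
      linarith
  exact closure_mono himg (image_closure_subset_closure_image hΨc ⟨z, hz, rfl⟩)

/-- **A THIN FAR-SIDE product cell: quadruple point, or away from the pole, or no triple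
point.** Data of `Hpar` over a product cell (`hsec`, `hne`, `hpole`) with the pole on the far
side (`hfar`) and `w < ε h` on the `x'`-cell (`hthin`); `HU` / `HQ` are the residual hypotheses
described in the module docstring (for the fixed `p`, `u`, `v`, `ε`). -/
theorem good_parCell_far_thin (ε : ℚ) (s : KZ.IntegralRep (B + 1 + 1)) (M : Fin m' → (Fin (B + 1) → ℚ) × ℚ)
    (M₀ : Fin m₀ → (Fin B → ℚ) × ℚ) (ylo yhi : (Fin B → ℚ) × ℚ) (p : MvPolynomial (Fin B) ℚ)
    (u v : (Fin (B + 1) → ℚ) × ℚ) (hbd : Bornology.IsBounded s.domain)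
    (hdom : s.domain = gDom B 1 m' M (fun _ => Sum.inr u) (fun _ => Sum.inr v))
    (hint : EqOn s.integrand (glit B 1 p L e ℓ₁ ℓ₂ 0 1 (fun _ => some 0)) s.domain)
    (hu : u.1 (Fin.last B) ≠ 0) (hpar : u.1 (Fin.last B) = v.1 (Fin.last B))
    (hcell : ∀ z : Fin (B + 1 + 1) → ℝ, (∀ j, 0 < affF B 1 (M j) z) → 0 < affF B 1 u z ∧ affF B 1 u z < affF B 1 v z)
    (hsec : ∀ z : Fin (B + 1 + 1) → ℝ, (∀ j, 0 < affF B 1 (M j) z) ↔ ((∀ j, 0 < affB B 1 (M₀ j) z) ∧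
      affB B 1 ylo z < z (Fin.castAdd 1 (Fin.last B)) ∧ z (Fin.castAdd 1 (Fin.last B)) < affB B 1 yhi z))
    (hne : ∀ z : Fin (B + 1 + 1) → ℝ, (∀ j, 0 < affB B 1 (M₀ j) z) → affB B 1 ylo z < affB B 1 yhi z)
    (hpole : ∀ z : Fin (B + 1 + 1) → ℝ, (∀ j, 0 < affB B 1 (M₀ j) z) →
      affB B 1 ℓ₂ z ≤ affB B 1 ylo z ∨ affB B 1 yhi z ≤ affB B 1 ℓ₂ z)
    (hfar : ∀ z : Fin (B + 1 + 1) → ℝ, (∀ j, 0 < affB B 1 (M₀ j) z) →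
      (0 < u.1 (Fin.last B) → affB B 1 ℓ₂ z ≤ affB B 1 ylo z) ∧ (u.1 (Fin.last B) < 0 → affB B 1 yhi z ≤ affB B 1 ℓ₂ z))
    (hthin : ∀ z : Fin (B + 1 + 1) → ℝ, (∀ j, 0 < affB B 1 (M₀ j) z) →
      affF B 1 v z - affF B 1 u z < ε * (affB B 1 yhi z - affB B 1 ylo z))
    (HU : ∀ (m'' m₀' : ℕ) (s' : KZ.IntegralRep (B + 1 + 1)) (M' : Fin m'' → (Fin (B + 1) → ℚ) × ℚ)
      (M₀' : Fin m₀' → (Fin B → ℚ) × ℚ) (ylo' yhi' : (Fin B → ℚ) × ℚ), Bornology.IsBounded s'.domain →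
      s'.domain = gDom B 1 m'' M' (fun _ => Sum.inr u) (fun _ => Sum.inr v) →
      EqOn s'.integrand (glit B 1 p L e ℓ₁ ℓ₂ 0 1 (fun _ => some 0)) s'.domain →
      (∀ z : Fin (B + 1 + 1) → ℝ, (∀ j, 0 < affF B 1 (M' j) z) → 0 < affF B 1 u z ∧ affF B 1 u z < affF B 1 v z) →
      (∀ z : Fin (B + 1 + 1) → ℝ, (∀ j, 0 < affF B 1 (M' j) z) ↔ ((∀ j, 0 < affB B 1 (M₀' j) z) ∧
        affB B 1 ylo' z < z (Fin.castAdd 1 (Fin.last B)) ∧ z (Fin.castAdd 1 (Fin.last B)) < affB B 1 yhi' z)) →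
      (∀ z : Fin (B + 1 + 1) → ℝ, (∀ j, 0 < affB B 1 (M₀' j) z) → affB B 1 ylo' z < affB B 1 yhi' z) →
      (∀ z : Fin (B + 1 + 1) → ℝ, (∀ j, 0 < affB B 1 (M₀' j) z) →
        (0 < u.1 (Fin.last B) → affB B 1 ℓ₂ z ≤ affB B 1 ylo' z) ∧ (u.1 (Fin.last B) < 0 → affB B 1 yhi' z ≤ affB B 1 ℓ₂ z)) →
      (∀ z : Fin (B + 1 + 1) → ℝ, (∀ j, 0 < affB B 1 (M₀' j) z) →
        affF B 1 v z - affF B 1 u z < ε * (affB B 1 yhi' z - affB B 1 ylo' z)) →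
      (∃ δ : ℝ, 0 < δ ∧ ∀ z : Fin (B + 1 + 1) → ℝ, (∀ j, 0 < affB B 1 (M₀' j) z) →
        δ ≤ |affB B 1 ylo' z - affB B 1 ℓ₂ z| ∧ δ ≤ |affB B 1 yhi' z - affB B 1 ℓ₂ z|) →
      (∃ z ∈ closure {z : Fin (B + 1 + 1) → ℝ | ∀ j, 0 < affF B 1 (M' j) z},
        affB B 1 ylo' z = affB B 1 yhi' z ∧ affF B 1 u z = affF B 1 v z ∧
          affB B 1 (restr B u) z + (u.1 (Fin.last B) : ℝ) * affB B 1 ℓ₂ z = 0) →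
      ∃ c ∈ AddSubgroup.closure (GGset B 2 1), KZ.of s' - c ∈ KZ.relations)
    (HQ : ∀ (m'' m₀' : ℕ) (s' : KZ.IntegralRep (B + 1 + 1)) (M' : Fin m'' → (Fin (B + 1) → ℚ) × ℚ)
      (M₀' : Fin m₀' → (Fin B → ℚ) × ℚ) (ylo' yhi' : (Fin B → ℚ) × ℚ), Bornology.IsBounded s'.domain →
      s'.domain = gDom B 1 m'' M' (fun _ => Sum.inr u) (fun _ => Sum.inr v) →
      EqOn s'.integrand (glit B 1 p L e ℓ₁ ℓ₂ 0 1 (fun _ => some 0)) s'.domain →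
      (∀ z : Fin (B + 1 + 1) → ℝ, (∀ j, 0 < affF B 1 (M' j) z) → 0 < affF B 1 u z ∧ affF B 1 u z < affF B 1 v z) →
      (∀ z : Fin (B + 1 + 1) → ℝ, (∀ j, 0 < affF B 1 (M' j) z) ↔ ((∀ j, 0 < affB B 1 (M₀' j) z) ∧
        affB B 1 ylo' z < z (Fin.castAdd 1 (Fin.last B)) ∧ z (Fin.castAdd 1 (Fin.last B)) < affB B 1 yhi' z)) →
      (∀ z : Fin (B + 1 + 1) → ℝ, (∀ j, 0 < affB B 1 (M₀' j) z) → affB B 1 ylo' z < affB B 1 yhi' z) →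
      (∀ z : Fin (B + 1 + 1) → ℝ, (∀ j, 0 < affB B 1 (M₀' j) z) →
        (0 < u.1 (Fin.last B) → affB B 1 ℓ₂ z ≤ affB B 1 ylo' z) ∧ (u.1 (Fin.last B) < 0 → affB B 1 yhi' z ≤ affB B 1 ℓ₂ z)) →
      (∀ z : Fin (B + 1 + 1) → ℝ, (∀ j, 0 < affB B 1 (M₀' j) z) →
        affF B 1 v z - affF B 1 u z < ε * (affB B 1 yhi' z - affB B 1 ylo' z)) →
      (∃ z ∈ closure {z : Fin (B + 1 + 1) → ℝ | ∀ j, 0 < affF B 1 (M' j) z},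
        affB B 1 ylo' z = affB B 1 yhi' z ∧ affF B 1 u z = affF B 1 v z ∧
          affB B 1 (restr B u) z + (u.1 (Fin.last B) : ℝ) * affB B 1 ℓ₂ z = 0 ∧ affB B 1 ylo' z = affB B 1 ℓ₂ z) →
      ∃ c ∈ AddSubgroup.closure (GGset B 2 1), KZ.of s' - c ∈ KZ.relations) :
    ∃ c ∈ AddSubgroup.closure (GGset B 2 1), KZ.of s - c ∈ KZ.relations := by
  set sq : ℚ := u.1 (Fin.last B) with hsq
  set sR : ℝ := (sq : ℝ) with hsR
  -- the four forms
  set hF : (Fin B → ℚ) × ℚ := yhi - ylo with hhF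
  set wF : (Fin B → ℚ) × ℚ := restr B v - restr B u with hwF
  set kF : (Fin B → ℚ) × ℚ := restr B u - (-sq) • ℓ₂ with hkF
  set aF : (Fin B → ℚ) × ℚ := if 0 < sq then ylo - ℓ₂ else ℓ₂ - yhi with haF
  have hhz : ∀ z : Fin (B + 1 + 1) → ℝ, affB B 1 hF z = affB B 1 yhi z - affB B 1 ylo z :=
    fun z => by rw [hhF, affB_sub]
  have hwz : ∀ z : Fin (B + 1 + 1) → ℝ, affB B 1 wF z = affF B 1 v z - affF B 1 u z :=
    fun z => by rw [hwF, affB_sub, width_eq u v hpar]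
  have hkz : ∀ z : Fin (B + 1 + 1) → ℝ, affB B 1 kF z = affB B 1 (restr B u) z + sR * affB B 1 ℓ₂ z :=
    fun z => by rw [hkF, affB_sub, affB_smul', hsR]; push_cast; ring
  have haz : ∀ z : Fin (B + 1 + 1) → ℝ, affB B 1 aF z =
      if 0 < sq then affB B 1 ylo z - affB B 1 ℓ₂ z else affB B 1 ℓ₂ z - affB B 1 yhi z := fun z => by
    rw [haF]; split_ifs <;> rw [affB_sub]
  have hsn : ¬ 0 < sq → sq < 0 := fun h => lt_of_le_of_ne (not_lt.1 h) hu
  -- on the `x'`-cell: `h, w > 0`, `a ≥ 0`; the `δ`-condition from `δ' < a`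
  have hpos : ∀ z : Fin (B + 1 + 1) → ℝ, (∀ j, 0 < affF B 1 (M j) z) →
      0 < affB B 1 hF z ∧ 0 < affB B 1 wF z ∧ 0 ≤ affB B 1 aF z := fun z hz => by
    obtain ⟨h0, hlo, hhi⟩ := (hsec z).1 hz
    obtain ⟨-, huv⟩ := hcell z hz
    rw [hhz, hwz, haz]
    refine ⟨by linarith, by linarith, ?_⟩
    split_ifs with h
    · linarith [(hfar z h0).1 h]
    · linarith [(hfar z h0).2 (hsn h)]
  have hδcond : ∀ (δ' : ℝ) (z : Fin (B + 1 + 1) → ℝ), (∀ j, 0 < affB B 1 (M₀ j) z) → δ' ≤ affB B 1 aF z →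
      δ' ≤ |affB B 1 ylo z - affB B 1 ℓ₂ z| ∧ δ' ≤ |affB B 1 yhi z - affB B 1 ℓ₂ z| := by
    intro δ' z hz hlt
    have hlh := hne z hz
    rw [haz] at hlt
    split_ifs at hlt with h
    · exact ⟨by linarith [le_abs_self (affB B 1 ylo z - affB B 1 ℓ₂ z)],
        by linarith [le_abs_self (affB B 1 yhi z - affB B 1 ℓ₂ z)]⟩
    · exact ⟨by linarith [neg_le_abs (affB B 1 ylo z - affB B 1 ℓ₂ z)],
        by linarith [neg_le_abs (affB B 1 yhi z - affB B 1 ℓ₂ z)]⟩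
  -- a quadruple point
  by_cases hq : ∃ z ∈ closure {z : Fin (B + 1 + 1) → ℝ | ∀ j, 0 < affF B 1 (M j) z},
      affB B 1 ylo z = affB B 1 yhi z ∧ affF B 1 u z = affF B 1 v z ∧
        affB B 1 (restr B u) z + (u.1 (Fin.last B) : ℝ) * affB B 1 ℓ₂ z = 0 ∧ affB B 1 ylo z = affB B 1 ℓ₂ z
  · exact HQ m' m₀ s M M₀ ylo yhi hbd hdom hint hcell hsec hne hfar hthin hq
  push Not at hq
  -- an empty domain
  rcases s.domain.eq_empty_or_nonempty with hemp | hne'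
  · exact good_of_null s (by rw [hemp, measure_empty])
  -- the level `μ`: minimum of `max (h, w, |κ'|, a)` on the closure of the domain
  have hdomf : ∀ z ∈ s.domain, 0 < affB B 1 hF z ∧ 0 < affB B 1 wF z ∧ 0 ≤ affB B 1 aF z := fun z hz => by
    rw [hdom, mem_gDom_one] at hz
    exact hpos z hz.1
  set φ : (Fin (B + 1 + 1) → ℝ) → ℝ := fun z =>
    max (max (max (affB B 1 hF z) (affB B 1 wF z)) |affB B 1 kF z|) (affB B 1 aF z) with hφ
  have hφc : Continuous φ :=
    (((continuous_affB_one hF).max (continuous_affB_one wF)).max (continuous_affB_one kF).abs).max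
      (continuous_affB_one aF)
  have hK : IsCompact (closure s.domain) := hbd.isCompact_closure
  have hKsub : closure s.domain ⊆ closure {z : Fin (B + 1 + 1) → ℝ | ∀ j, 0 < affF B 1 (M j) z} :=
    closure_mono fun z hz => by
      rw [hdom, mem_gDom_one] at hz
      exact hz.1
  have hKle : ∀ (d : (Fin B → ℚ) × ℚ), (∀ z ∈ s.domain, 0 ≤ affB B 1 d z) → ∀ z ∈ closure s.domain, 0 ≤ affB B 1 d z :=
    fun d hd z hz => closure_minimal (fun z hz => (hd z hz : z ∈ {z | 0 ≤ affB B 1 d z}))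
      (isClosed_le continuous_const (continuous_affB_one d)) hz
  have hKh := hKle hF fun z hz => (hdomf z hz).1.le
  have hKw := hKle wF fun z hz => (hdomf z hz).2.1.le
  have hKa := hKle aF fun z hz => (hdomf z hz).2.2
  have hφpos : ∀ z ∈ closure s.domain, 0 < φ z := fun z hz => by
    by_contra hle
    push Not at hle
    have h1 : affB B 1 hF z = 0 :=
      le_antisymm ((le_max_left _ _).trans ((le_max_left _ _).trans ((le_max_left _ _).trans hle))) (hKh z hz)
    have h2 : affB B 1 wF z = 0 :=
      le_antisymm ((le_max_right _ _).trans ((le_max_left _ _).trans ((le_max_left _ _).trans hle))) (hKw z hz)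
    have h3 : |affB B 1 kF z| = 0 := le_antisymm ((le_max_right _ _).trans ((le_max_left _ _).trans hle)) (abs_nonneg _)
    have h4 : affB B 1 aF z = 0 := le_antisymm ((le_max_right _ _).trans hle) (hKa z hz)
    rw [hhz, sub_eq_zero] at h1
    rw [hwz, sub_eq_zero] at h2
    rw [abs_eq_zero, hkz] at h3
    rw [haz] at h4
    refine hq z (hKsub hz) h1.symm h2.symm h3 ?_
    split_ifs at h4 with h
    · linarith
    · linarith
  obtain ⟨z₀, hz₀, hmin⟩ := hK.exists_isMinOn hne'.closure hφc.continuousOn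
  set μ : ℝ := φ z₀ with hμ
  have hμ0 : 0 < μ := hφpos z₀ hz₀
  have hμle : ∀ z ∈ closure s.domain, μ ≤ φ z := fun z hz => hmin hz
  obtain ⟨δ', hδ0, hδμ⟩ := exists_rat_btwn hμ0
  -- sub-cell bookkeeping: a sub-cell with `a > δ'` on its `x'`-cell
  have hU : ∀ {m'' m₀' : ℕ} (s' : KZ.IntegralRep (B + 1 + 1)) (M' : Fin m'' → (Fin (B + 1) → ℚ) × ℚ)
      (M₀' : Fin m₀' → (Fin B → ℚ) × ℚ), s'.domain ⊆ s.domain → s'.integrand = s.integrand →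
      s'.domain = gDom B 1 m'' M' (fun _ => Sum.inr u) (fun _ => Sum.inr v) →
      (∀ z : Fin (B + 1 + 1) → ℝ, (∀ j, 0 < affF B 1 (M' j) z) ↔ ((∀ j, 0 < affB B 1 (M₀' j) z) ∧
        affB B 1 ylo z < z (Fin.castAdd 1 (Fin.last B)) ∧ z (Fin.castAdd 1 (Fin.last B)) < affB B 1 yhi z)) →
      (∀ z : Fin (B + 1 + 1) → ℝ, (∀ j, 0 < affB B 1 (M₀' j) z) → (∀ j, 0 < affB B 1 (M₀ j) z) ∧ (δ' : ℝ) ≤ affB B 1 aF z) →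
      ∃ c ∈ AddSubgroup.closure (GGset B 2 1), KZ.of s' - c ∈ KZ.relations := by
    intro m'' m₀' s' M' M₀' hsub hi' hd' hsec' hrows'
    have hint' : EqOn s'.integrand (glit B 1 p L e ℓ₁ ℓ₂ 0 1 (fun _ => some 0)) s'.domain := by
      rw [hi']; exact hint.mono hsub
    have hbase : ∀ z : Fin (B + 1 + 1) → ℝ, (∀ j, 0 < affF B 1 (M' j) z) → ∀ j, 0 < affF B 1 (M j) z :=
      fun z hz => by
        obtain ⟨h0, hlo, hhi⟩ := (hsec' z).1 hz
        exact (hsec z).2 ⟨(hrows' z h0).1, hlo, hhi⟩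
    have hcell' : ∀ z : Fin (B + 1 + 1) → ℝ, (∀ j, 0 < affF B 1 (M' j) z) →
        0 < affF B 1 u z ∧ affF B 1 u z < affF B 1 v z := fun z hz => hcell z (hbase z hz)
    by_cases htr : ∃ z ∈ closure {z : Fin (B + 1 + 1) → ℝ | ∀ j, 0 < affF B 1 (M' j) z},
        affB B 1 ylo z = affB B 1 yhi z ∧ affF B 1 u z = affF B 1 v z ∧
          affB B 1 (restr B u) z + (u.1 (Fin.last B) : ℝ) * affB B 1 ℓ₂ z = 0
    · exact HU m'' m₀' s' M' M₀' ylo yhi (hbd.subset hsub) hd' hint' hcell' hsec'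
        (fun z hz => hne z (hrows' z hz).1) (fun z hz => hfar z (hrows' z hz).1)
        (fun z hz => hthin z (hrows' z hz).1)
        ⟨δ', hδ0, fun z hz => hδcond δ' z (hrows' z hz).1 (hrows' z hz).2⟩ htr
    · push Not at htr
      exact good_parCell_of_noTriple L e ℓ₁ ℓ₂ s' M' M₀' ylo yhi p u v (hbd.subset hsub) hd' hint' hu hpar
        hcell' hsec' (fun z hz => hne z (hrows' z hz).1) (fun z hz => hpole z (hrows' z hz).1)
        fun z hz h1 h2 h3 => htr z hz h1 h2 h3
  -- the cut at `a = δ'`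
  set g : (Fin B → ℚ) × ℚ := aF - ((0 : Fin B → ℚ), δ') with hg
  have hgz : ∀ z : Fin (B + 1 + 1) → ℝ, affB B 1 g z = affB B 1 aF z - δ' := fun z => by
    rw [hg, affB_sub, affB_const]
  by_cases hg0 : g = 0
  · -- `a = δ'` identically
    refine hU s M M₀ Subset.rfl rfl hdom hsec fun z hz => ⟨hz, ?_⟩
    have h := hgz z
    rw [hg0, affB_zeroYT] at h
    linarith
  obtain ⟨s₁, s₂, hsub₁, hsub₂, hi₁, hi₂, hd₁, hd₂, hsec₁, hsec₂, hrel⟩ :=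
    cutCell s M M₀ ylo yhi u v hdom hsec g hg0
  refine good_of_split hrel ?_ ?_
  · -- `a > δ'`
    refine hU s₁ _ (Fin.snoc M₀ g) hsub₁ hi₁ hd₁ hsec₁ fun z hz => ?_
    obtain ⟨h0, h1⟩ := rowsB_snoc_iff.1 hz
    rw [hgz] at h1
    exact ⟨h0, by linarith⟩
  · -- `a < δ'`: no triple point on the closed cell
    have hint₂ : EqOn s₂.integrand (glit B 1 p L e ℓ₁ ℓ₂ 0 1 (fun _ => some 0)) s₂.domain := by
      rw [hi₂]; exact hint.mono hsub₂
    have hcell₂ : ∀ z : Fin (B + 1 + 1) → ℝ, (∀ j, 0 < affF B 1 ((Fin.snoc M (-liftX g) : Fin (m' + 1) → _) j) z) →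
        0 < affF B 1 u z ∧ affF B 1 u z < affF B 1 v z := fun z hz => hcell z (rows_snoc hz).1
    refine good_parCell_of_noTriple L e ℓ₁ ℓ₂ s₂ _ (Fin.snoc M₀ (-g)) ylo yhi p u v (hbd.subset hsub₂) hd₂ hint₂ hu hpar
      hcell₂ hsec₂ (fun z hz => hne z (rowsB_snoc_iff.1 hz).1) (fun z hz => hpole z (rowsB_snoc_iff.1 hz).1)
      fun z hz h1 h2 h3 => ?_
    -- `a ≤ δ'` on the closed cell
    have hale : affB B 1 aF z ≤ δ' :=
      le_of_closure_rows (continuous_affB_one aF) continuous_const (fun w hw => by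
        have h := (rows_snoc hw).2
        rw [affF_neg', affF_liftX, hgz] at h
        linarith) z hz
    -- lift `z` into the closure of the domain
    have hz' := hμle _ (closure_mono hsub₂ (update_mem_closure_domain s₂ _ u v hd₂ hcell₂ hz))
    rw [hφ] at hz'
    dsimp only at hz'
    rw [affB_update_tI, affB_update_tI, affB_update_tI, affB_update_tI, hhz, hwz, hkz, h1, h2, h3, sub_self, sub_self,
      abs_zero, max_self, max_self] at hz'
    have : max 0 (affB B 1 aF z) ≤ δ' := max_le hδ0.le hale
    linarith

end ThinQuad

end RebasePos

/-- **Registered part of `stub_rebaseSimplePosOnePos` (line `janus-bands`): a THIN FAR-SIDE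
product cell from cells away from the pole or with a quadruple point** (any base dimension;
`RebasePos.good_parCell_far_thin` with the two residual hypotheses merged into `HUQ`). Data of
`Hpar` over a product cell `{x'-rows M₀} × (ylo, yhi)` (`hsec`) with non-degenerate `y`-range,
the pole on the far side (`hfar`) and `v − u < ε (yhi − ylo)` on the `x'`-cell (`hthin`):
`[s] ∈ closure (GG B 2 1)` modulo `KZ.relations` as soon as (`HUQ`) this holds for such cells
that are moreover at distance `≥ δ > 0` from the pole with a triple point on the closed cell, or
have a quadruple point `ylo = yhi = ℓ₂`, `u = v`, `u₀ + s ℓ₂ = 0` on the closed cell. -/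
theorem rebaseSimplePos_par_farThin (B m m' m₀ : ℕ) (ε : ℚ) (s : KZ.IntegralRep (B + 1 + 1)) (M : Fin m' → (Fin (B + 1) → ℚ) × ℚ) (M₀ : Fin m₀ → (Fin B → ℚ) × ℚ) (ylo yhi : (Fin B → ℚ) × ℚ) (L : Fin m → (Fin B → ℚ) × ℚ) (e : Fin m → ℕ) (p : MvPolynomial (Fin B) ℚ) (ℓ₁ ℓ₂ : (Fin B → ℚ) × ℚ) (u v : (Fin (B + 1) → ℚ) × ℚ) (hbd : Bornology.IsBounded s.domain) (hdom : s.domain = SeparatePos.gDom B 1 m' M (fun _ => Sum.inr u) (fun _ => Sum.inr v)) (hint : Set.EqOn s.integrand (RebasePos.glit B 1 p L e ℓ₁ ℓ₂ 0 1 (fun _ => some 0)) s.domain) (hu : u.1 (Fin.last B) ≠ 0) (hpar : u.1 (Fin.last B) = v.1 (Fin.last B)) (hcell : ∀ z : Fin (B + 1 + 1) → ℝ, (∀ j, 0 < SeparatePos.affF B 1 (M j) z) → 0 < SeparatePos.affF B 1 u z ∧ SeparatePos.affF B 1 u z < SeparatePos.affF B 1 v z) (hsec : ∀ z : Fin (B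 + 1 + 1) → ℝ, (∀ j, 0 < SeparatePos.affF B 1 (M j) z) ↔ ((∀ j, 0 < SeparatePos.affB B 1 (M₀ j) z) ∧ SeparatePos.affB B 1 ylo z < z (Fin.castAdd 1 (Fin.last B)) ∧ z (Fin.castAdd 1 (Fin.last B)) < SeparatePos.affB B 1 yhi z)) (hne : ∀ z : Fin (B + 1 + 1) → ℝ, (∀ j, 0 < SeparatePos.affB B 1 (M₀ j) z) → SeparatePos.affB B 1 ylo z < SeparatePos.affB B 1 yhi z) (hfar : ∀ z : Fin (B + 1 + 1) → ℝ, (∀ j, 0 < SeparatePos.affB B 1 (M₀ j) z) → (0 < u.1 (Fin.last B) → SeparatePos.affB B 1 ℓ₂ z ≤ SeparatePos.affB B 1 ylo z) ∧ (u.1 (Fin.last B) < 0 → SeparatePos.affB B 1 yhi z ≤ SeparatePos.affB B 1 ℓ₂ z)) (hthin : ∀ z : Fin (B + 1 + 1) → ℝ, (∀ j, 0 < SeparatePos.affB B 1 (M₀ j) z) → SeparatePos.affF B 1 v z - SeparatePos.affF B 1 u z < ε * (SeparatePos.affB B 1 yhi z - SeparatePos.affB B 1 ylo z)) (HUQ :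 ∀ (m'' m₀' : ℕ) (s' : KZ.IntegralRep (B + 1 + 1)) (M' : Fin m'' → (Fin (B + 1) → ℚ) × ℚ) (M₀' : Fin m₀' → (Fin B → ℚ) × ℚ) (ylo' yhi' : (Fin B → ℚ) × ℚ), Bornology.IsBounded s'.domain → s'.domain = SeparatePos.gDom B 1 m'' M' (fun _ => Sum.inr u) (fun _ => Sum.inr v) → EqOn s'.integrand (RebasePos.glit B 1 p L e ℓ₁ ℓ₂ 0 1 (fun _ => some 0)) s'.domain → (∀ z : Fin (B + 1 + 1) → ℝ, (∀ j, 0 < SeparatePos.affF B 1 (M' j) z) → 0 < SeparatePos.affF B 1 u z ∧ SeparatePos.affF B 1 u z < SeparatePos.affF B 1 v z) → (∀ z : Fin (B + 1 + 1) → ℝ, (∀ j, 0 < SeparatePos.affF B 1 (M' j) z) ↔ ((∀ j, 0 < SeparatePos.affB B 1 (M₀' j) z) ∧ SeparatePos.affB B 1 ylo' z < z (Fin.castAdd 1 (Fin.last B)) ∧ z (Fin.castAdd 1 (Fin.last B)) < SeparatePos.affB B 1 yhi' z)) → (∀ z : Fin (B + 1 + 1) → ℝ, (∀ j, 0 < SeparatePos.affB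 B 1 (M₀' j) z) → SeparatePos.affB B 1 ylo' z < SeparatePos.affB B 1 yhi' z) → (∀ z : Fin (B + 1 + 1) → ℝ, (∀ j, 0 < SeparatePos.affB B 1 (M₀' j) z) → (0 < u.1 (Fin.last B) → SeparatePos.affB B 1 ℓ₂ z ≤ SeparatePos.affB B 1 ylo' z) ∧ (u.1 (Fin.last B) < 0 → SeparatePos.affB B 1 yhi' z ≤ SeparatePos.affB B 1 ℓ₂ z)) → (∀ z : Fin (B + 1 + 1) → ℝ, (∀ j, 0 < SeparatePos.affB B 1 (M₀' j) z) → SeparatePos.affF B 1 v z - SeparatePos.affF B 1 u z < ε * (SeparatePos.affB B 1 yhi' z - SeparatePos.affB B 1 ylo' z)) → ((∃ δ : ℝ, 0 < δ ∧ ∀ z : Fin (B + 1 + 1) → ℝ, (∀ j, 0 < SeparatePos.affB B 1 (M₀' j) z) → δ ≤ |SeparatePos.affB B 1 ylo' z - SeparatePos.affB B 1 ℓ₂ z| ∧ δ ≤ |SeparatePos.affB B 1 yhi' z - SeparatePos.affB B 1 ℓ₂ z|) ∧ (∃ z ∈ closure {z : Fin (B + 1 + 1) → ℝ | ∀ j,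 0 < SeparatePos.affF B 1 (M' j) z}, SeparatePos.affB B 1 ylo' z = SeparatePos.affB B 1 yhi' z ∧ SeparatePos.affF B 1 u z = SeparatePos.affF B 1 v z ∧ SeparatePos.affB B 1 (SeparatePos.restr B u) z + (u.1 (Fin.last B) : ℝ) * SeparatePos.affB B 1 ℓ₂ z = 0)) ∨ (∃ z ∈ closure {z : Fin (B + 1 + 1) → ℝ | ∀ j, 0 < SeparatePos.affF B 1 (M' j) z}, SeparatePos.affB B 1 ylo' z = SeparatePos.affB B 1 yhi' z ∧ SeparatePos.affF B 1 u z = SeparatePos.affF B 1 v z ∧ SeparatePos.affB B 1 (SeparatePos.restr B u) z + (u.1 (Fin.last B) : ℝ) * SeparatePos.affB B 1 ℓ₂ z = 0 ∧ SeparatePos.affB B 1 ylo' z = SeparatePos.affB B 1 ℓ₂ z) → ∃ c ∈ AddSubgroup.closure (SeparatePos.GGset B 2 1), KZ.of s' - c ∈ KZ.relations) : ∃ c ∈ AddSubgroup.closure (SeparatePos.GGset B 2 1), KZ.of s - c ∈ KZ.relations :=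
  RebasePos.good_parCell_far_thin L e ℓ₁ ℓ₂ ε s M M₀ ylo yhi p u v hbd hdom hint hu hpar hcell hsec hne
    (fun z hz => by
      rcases lt_or_gt_of_ne hu with hn | hp
      · exact Or.inr ((hfar z hz).2 hn)
      · exact Or.inl ((hfar z hz).1 hp))
    hfar hthin
    (fun m'' m₀' s' M' M₀' ylo' yhi' hbd' hdom' hint' hcell' hsec' hne' hfar' hthin' hδ htr =>
      HUQ m'' m₀' s' M' M₀' ylo' yhi' hbd' hdom' hint' hcell' hsec' hne' hfar' hthin' (Or.inl ⟨hδ, htr⟩))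
    (fun m'' m₀' s' M' M₀' ylo' yhi' hbd' hdom' hint' hcell' hsec' hne' hfar' hthin' hq =>
      HUQ m'' m₀' s' M' M₀' ylo' yhi' hbd' hdom' hint' hcell' hsec' hne' hfar' hthin' (Or.inr hq))

end Summit.KontsevichZagierPeriods.ArrangementNormalForm.JanusBands
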